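import Literature.AlgebraicGeometry.Frobenioids.Cor411SubReductions
import Literature.AlgebraicGeometry.Frobenioids.DivisorMonoidCategoryTheoreticityFactsCor411iiHolds
import HarnessLib

/-!
# Frobenioids I, Corollary 4.11 (ii), sub-node L11: the named fact `FrdI.BiratEquivPreservesUnits` HOLDS

Mochizuki, *The geometry of Frobenioids I: the general theory*, Kyushu J. Math. **62** (2008)
293–400, proof of Cor. 4.11 (ii), p. 93 ll. 36–46 [cite: MochizukiFrdI2008, Cor. 4.11 (ii) p.93]: "we thus
conclude that `Ψ^birat` preserves the base-identity endomorphisms [hence, in particular, that `Ψ^birat`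
preserves '`O^×(−)`']" — for EVERY equivalence `E : C₁^birat ⥲ C₂^birat` lying over `Ψ` and its
quasi-inverse (`1`-uniqueness of `Ψ^birat`, Cor. 4.10).

PROOF-ONLY companion of `Cor411Sub.lean` (typer abc-iut-L1-t3 / abc-iut-L1-d6; cell fact row F-2325;
seat abc-iut-f-029): the reduction `FrdI.biratEquivPreservesUnits_of_cor411ii` (this seat,
`Cor411SubReductions.lean`: L11 is elementary given the base squares of `Ψ` and `Ψ⁻¹`) applied to the
theorem `FrdI.Cor411ii_holds` (seat abc-iut-f-037, `DivisorMonoidCategoryTheoreticityFactsCor411iiHolds.lean`;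
2008 wording of "FSMFF-type"). Not circular: the tree's proof of Cor. 4.11 (ii) runs along the author's
amended route (Comments 2024 (29)(v)) and does not use L11 at general `C`. Nothing of [FrdI] is restated;
no new definitions; nothing here is specific to the abc programme.
-/

namespace Literature.AlgebraicGeometry.Frobenioids

universe w v v' u u'

namespace FrdI

/-- **The named fact [FrdI] Cor. 4.11 (ii), sub-node L11, `FrdI.BiratEquivPreservesUnits`, HOLDS** —
`biratEquivPreservesUnits_of_cor411ii Cor411ii_holds`. [cite: MochizukiFrdI2008, Cor. 4.11 (ii) p.93] -/
theorem BiratEquivPreservesUnits_holds :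
    Literature.AlgebraicGeometry.Frobenioids.FrdI.BiratEquivPreservesUnits.{w, v, v', u, u'} :=
  biratEquivPreservesUnits_of_cor411ii Cor411ii_holds

end FrdI

end Literature.AlgebraicGeometry.Frobenioids
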